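import Literature.NumberTheory.Automorphic.UnitaryCentralizerWindowCompact        -- ⊙ A2 (field level): `exists_isCompact_isOpen_nhds_conj_mem_imp_commute`
import Literature.NumberTheory.Rogawski1990.LocalEndoscopicSliceDatumCM            -- ★ p841067: one-place model plumbing at a non-split `v` (+ its imports)
import Literature.NumberTheory.Automorphic.UnitaryGroupInertPlaceHyperbolicBasis    -- ★ `galAdicCompletionMap_galAdicCompletionMap_of_smul_eq`, ★ `placeForm_hermitian_of_smul_eq`
import HarnessLib

/-!
# «COMPACT MODULO THE CENTRALISER» ON `U(H)(L⁺_v)` AT A SINGULAR SEMISIMPLE `ε₀`, non-split `v` (N6nsGerm (S1)∕(S2), binder (B4-top)(3), the CM DRESS — FILE B)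

Topic `NumberTheory/Rogawski1990`; namespace `Literature.NumberTheory.Rogawski1990`. KERNEL mathematics only: one theorem (+ private helpers), no definition, no named fact,
no instance, no notation, no `sorry`.  Cell `pub/hodgecm-mathlib` (LEAD F0P3a-plan (g9) T8-38 (1); road «N6nsGerm»: p08 (g13)'s Ad(M)-invariant `β`-cut-off descent (binder B4 of
★ p841395) needs, for `Ω ⊆ G′_v` compact, a compact `C` with `{x ∣ ∃ t ∈ B₁, x t x⁻¹ ∈ Ω} ⊆ C · Z(ε₀)`; p08 «=» 05:43:27Z on this shape (q1)(q2)(q3)).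

THE STATEMENT.  `v` non-split (`w ∣ v`, `w̄ = w`), `H` hermitian with unit determinant, `ε₀ ∈ G′_v = U(H)(L⁺_v)` with a frame over `L ⊗ L⁺_v`:
`ε₀ P₀ = P₀ · (a·1_{N₁} ⊕ᶠ u·1₁)`, `a ≠ u`, `u·ū = 1` (e.g. `ε₀ = ι(a·1₂, u)`, (S1); `ι(A_{a,b}, a)` reframed as `a·1₂ ⊕ b`, (S2)).  Then there is a COMPACT OPEN
`B₁ ∋ ε₀` in `Z(ε₀)` such that for every compact `Ω ⊆ G′_v` some compact `C ⊆ G′_v` has: `x t x⁻¹ ∈ Ω` with `t ∈ B₁` ⇒ `x ∈ C · Z(ε₀)`.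
PROOF = ⊙ A2 `exists_isCompact_isOpen_nhds_conj_mem_imp_commute` at the one-place image `φ ε₀` (`φ = localNonsplitEquiv`; `L_w` complete proper totally disconnected of
characteristic `0`, `c_w` a continuous ISOMETRIC INVOLUTION — ★ `galAdicCompletionMap_galAdicCompletionMap_of_smul_eq`, ★ `valued_galAdicCompletionMap` — and `H_w` hermitian
★ `placeForm_hermitian_of_smul_eq`), frame mapped as in ★ p841067 §2, everything transported back along `φ⁻¹` (★ `exists_homeomorph_centralizer_map`).

* **`exists_isCompact_isOpen_nhds_conj_mem_imp_mem_mul_centralizer`**.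

HONEST SCOPE.  HC_CM is proved only modulo the printed citations until rung 0 closes; this file discharges no printed statement.

## References
* [HarishChandra1970] Harish-Chandra (notes by G. van Dijk), *Harmonic Analysis on Reductive p-adic Groups*, LNM 162 (1970), Part I §3 Lemma 19 + Corollary; Part II §5.
* [Rogawski1990] J. D. Rogawski, *Automorphic Representations of Unitary Groups in Three Variables*, Ann. of Math. Stud. 123 (1990), §3.8 Prop. 3.8.1 p. 30, §8.2 Prop. 8.2.1 pp. 112–116.
* [PlatonovRapinchuk1994] V. Platonov, A. Rapinchuk, *Algebraic Groups and Number Theory* (1994), §5.1 (the one-place model).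
-/

set_option autoImplicit false

noncomputable section

open Set Filter Topology Polynomial NumberField IsDedekindDomain
open Literature.NumberTheory.Automorphic Literature.NumberTheory.Automorphic.UnitaryGroup Literature.Analysis.Calculus
open scoped Matrix MatrixGroups Pointwise

namespace Literature.NumberTheory.Rogawski1990

variable (L : Type) [Field L] [NumberField L] [IsCMField L] {v : HeightOneSpectrum (𝓞 ↥(maximalRealSubfield L))}

section CompactModCentralizer

variable {N₁ : ℕ} (H : Matrix (Fin (N₁ + 1)) (Fin (N₁ + 1)) L)

/-- `conjLocal` at the unique place above a non-split `v` is the Galois transport `c_w` on that factor. [cite: PlatonovRapinchuk1994, §5.1] -/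
private theorem conjLocal_apply_of_smul_eq' (w : PlacesOver L v) (hw : IsCMField.complexConj L • w.1 = w.1) (x : LocalRing L v) :
    UnitaryGroup.conjLocal L (IsCMField.complexConj L) v x w = galAdicCompletionMap (L := L) (IsCMField.complexConj L) hw (x w) := by
  have key : ∀ (w₁ : PlacesOver L v) (h₁ : IsCMField.complexConj L • w₁.1 = w.1),
      galAdicCompletionMap (L := L) (IsCMField.complexConj L) h₁ (x w₁) = galAdicCompletionMap (L := L) (IsCMField.complexConj L) hw (x w) := by
    intro w₁ h₁
    have e : w₁ = w := PlacesOver.eq_of_smul_eq (IsCMField.complexConj L) (IsCMField.complexConj_ne_one L) w hw w₁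
    subst e
    rfl
  rw [UnitaryGroup.conjLocal_apply]
  exact key ⟨(IsCMField.complexConj L)⁻¹ • w.1, UnitaryGroup.under_inv_smul_eq (IsCMField.complexConj L) w⟩ (smul_inv_smul (IsCMField.complexConj L) w.1)

set_option maxHeartbeats 1000000 in
/-- **(B4-top)(3) CM DRESS — COMPACT MODULO `Z(ε₀)` on `U(H)(L⁺_v)`.** See the module docstring.
[cite: HarishChandra1970, Part I §3 Lemma 19; Part II §5] [cite: Rogawski1990, §8.2 Prop. 8.2.1 pp. 112–116; §3.8 Prop. 3.8.1 p. 30] [cite: PlatonovRapinchuk1994, §5.1] -/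
theorem exists_isCompact_isOpen_nhds_conj_mem_imp_mem_mul_centralizer (hH : (H.map (cmConjRingHom L))ᵀ = H) (hHd : IsUnit H.det)
    (w : PlacesOver L v) (hw : IsCMField.complexConj L • w.1 = w.1)
    (ε₀ : (cmDatum L (N₁ + 1) H).Local v) (P₀ : GL (Fin (N₁ + 1)) (LocalRing L v)) {a u : LocalRing L v} (hau : a ≠ u)
    (hu1 : u * UnitaryGroup.conjLocal L (IsCMField.complexConj L) v u = 1)
    (hP₀ : (ε₀.val.val : Matrix (Fin (N₁ + 1)) (Fin (N₁ + 1)) (LocalRing L v)) * P₀.val =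
      P₀.val * finSum N₁ 1 (a • (1 : Matrix (Fin N₁) (Fin N₁) (LocalRing L v))) (u • (1 : Matrix (Fin 1) (Fin 1) (LocalRing L v)))) :
    ∃ B₁ : Set ↥(Subgroup.centralizer ({ε₀} : Set ((cmDatum L (N₁ + 1) H).Local v))), IsCompact B₁ ∧ IsOpen B₁ ∧ (⟨ε₀, Subgroup.mem_centralizer_singleton_iff.2 rfl⟩ : ↥(Subgroup.centralizer ({ε₀} : Set ((cmDatum L (N₁ + 1) H).Local v)))) ∈ B₁ ∧
      ∀ Ω : Set ((cmDatum L (N₁ + 1) H).Local v), IsCompact Ω → ∃ C : Set ((cmDatum L (N₁ + 1) H).Local v), IsCompact C ∧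
        ∀ x : (cmDatum L (N₁ + 1) H).Local v, ∀ t ∈ B₁, x * (t : (cmDatum L (N₁ + 1) H).Local v) * x⁻¹ ∈ Ω → x ∈ C * (Subgroup.centralizer ({ε₀} : Set ((cmDatum L (N₁ + 1) H).Local v)) : Set ((cmDatum L (N₁ + 1) H).Local v)) := by
  classical
  letI : Unique (PlacesOver L v) :=
    @uniqueOfSubsingleton _ (PlacesOver.subsingleton_of_smul_eq (IsCMField.complexConj L) (IsCMField.complexConj_ne_one L) w hw) w
  -- `L_w` as a complete proper totally disconnected non-trivially normed field of characteristic zero; `c_w` continuous isometric involution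
  letI : NontriviallyNormedField (w.1.adicCompletion L) := Valued.toNontriviallyNormedField (w.1.adicCompletion L) (WithZero (Multiplicative ℤ))
  haveI : ProperSpace (w.1.adicCompletion L) := properSpace_adicCompletion L w.1
  haveI : CharZero (w.1.adicCompletion L) := charZero_of_injective_algebraMap (algebraMap L _).injective
  haveI : TotallyDisconnectedSpace (w.1.adicCompletion L) := Valued.totallyDisconnectedSpace'
  have hσc := continuous_galAdicCompletionMap L (IsCMField.complexConj L) hw
  have hσσ : ∀ s, galAdicCompletionMap (L := L) (IsCMField.complexConj L) hw (galAdicCompletionMap (L := L) (IsCMField.complexConj L) hw s) = s :=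
    galAdicCompletionMap_galAdicCompletionMap_of_smul_eq (IsCMField.complexConj L) w (IsCMField.complexConj_ne_one L) hw
  have hσi : ∀ s : w.1.adicCompletion L, ‖galAdicCompletionMap (L := L) (IsCMField.complexConj L) hw s‖ = ‖s‖ := fun s =>
    le_antisymm (Valued.toNormedField.norm_le_iff.2 (by rw [valued_galAdicCompletionMap]))
      (Valued.toNormedField.norm_le_iff.2 (by rw [valued_galAdicCompletionMap]))
  have hHc : (H.map (IsCMField.complexConj L))ᵀ = H := by rw [← map_cmConjRingHom_eq_map_complexConj]; exact hH
  have hJw : ((placeForm H w.1).map (galAdicCompletionMap (L := L) (IsCMField.complexConj L) hw))ᵀ = placeForm H w.1 :=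
    placeForm_hermitian_of_smul_eq (IsCMField.complexConj L) w H hHc hw
  have hJd : (placeForm H w.1).det ≠ 0 := ((Matrix.isUnit_iff_isUnit_det _).1 (isUnit_placeForm_of_isUnit_det hHd w.1)).ne_zero
  set φ := localNonsplitEquiv (IsCMField.complexConj L) H (IsCMField.complexConj_ne_one L) w hw with hφ
  -- the frame over `L_w`
  set ψ : LocalRing L v →+* w.1.adicCompletion L := Pi.evalRingHom (fun w' : PlacesOver L v => w'.1.adicCompletion L) w with hψdef
  have hψinj : Function.Injective ψ := by
    have hψ : ψ = (RingEquiv.piUnique fun w' : PlacesOver L v => w'.1.adicCompletion L).toRingHom := RingHom.ext fun _ => rfl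
    rw [hψ]
    exact (RingEquiv.piUnique fun w' : PlacesOver L v => w'.1.adicCompletion L).injective
  have hmat : (((φ ε₀ : ↥(unitaryGroupOfForm (galAdicCompletionMap (L := L) (IsCMField.complexConj L) hw) (placeForm H w.1))) : GL (Fin (N₁ + 1)) (w.1.adicCompletion L)) : Matrix (Fin (N₁ + 1)) (Fin (N₁ + 1)) (w.1.adicCompletion L)) =
      (ε₀.val.val : Matrix (Fin (N₁ + 1)) (Fin (N₁ + 1)) (LocalRing L v)).map ψ := rfl
  have hsmul : ∀ (k : ℕ) (c : LocalRing L v), (c • (1 : Matrix (Fin k) (Fin k) (LocalRing L v))).map ψ = ψ c • (1 : Matrix (Fin k) (Fin k) (w.1.adicCompletion L)) :=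
    fun k c => by rw [Matrix.smul_one_eq_diagonal, Matrix.diagonal_map (map_zero ψ), Matrix.smul_one_eq_diagonal]
  have hfin : (finSum N₁ 1 (a • (1 : Matrix (Fin N₁) (Fin N₁) (LocalRing L v))) (u • (1 : Matrix (Fin 1) (Fin 1) (LocalRing L v)))).map ψ =
      Matrix.reindex finSumFinEquiv finSumFinEquiv
        (Matrix.fromBlocks (ψ a • (1 : Matrix (Fin N₁) (Fin N₁) (w.1.adicCompletion L))) 0 0 (ψ u • (1 : Matrix (Fin 1) (Fin 1) (w.1.adicCompletion L)))) := by
    rw [finSum, Matrix.reindex_apply, Matrix.reindex_apply, ← Matrix.submatrix_map, Matrix.fromBlocks_map, hsmul, hsmul, Matrix.map_zero ψ (map_zero ψ),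
      Matrix.map_zero ψ (map_zero ψ)]
  have hP : (((φ ε₀ : ↥(unitaryGroupOfForm (galAdicCompletionMap (L := L) (IsCMField.complexConj L) hw) (placeForm H w.1))) : GL (Fin (N₁ + 1)) (w.1.adicCompletion L)) : Matrix (Fin (N₁ + 1)) (Fin (N₁ + 1)) (w.1.adicCompletion L)) *
        (Matrix.GeneralLinearGroup.map ψ P₀).val =
      (Matrix.GeneralLinearGroup.map ψ P₀).val * Matrix.reindex finSumFinEquiv finSumFinEquiv
        (Matrix.fromBlocks (ψ a • (1 : Matrix (Fin N₁) (Fin N₁) (w.1.adicCompletion L))) 0 0 (ψ u • (1 : Matrix (Fin 1) (Fin 1) (w.1.adicCompletion L)))) := by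
    have h := congrArg (fun M : Matrix (Fin (N₁ + 1)) (Fin (N₁ + 1)) (LocalRing L v) => M.map ψ) hP₀
    simp only [Matrix.map_mul] at h
    rw [hmat, ← hfin]
    exact h
  have hau' : ψ a ≠ ψ u := hψinj.ne hau
  have hu1' : ψ u * galAdicCompletionMap (L := L) (IsCMField.complexConj L) hw (ψ u) = 1 := by
    have h := congrArg ψ hu1
    rw [map_mul, map_one] at h
    have h2 : ψ (UnitaryGroup.conjLocal L (IsCMField.complexConj L) v u) = galAdicCompletionMap (L := L) (IsCMField.complexConj L) hw (ψ u) :=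
      conjLocal_apply_of_smul_eq' L w hw u
    rwa [h2] at h
  -- FILE A2 at the one-place image
  obtain ⟨B₁', hB₁c', hB₁o', hmem', hmain'⟩ :=
    exists_isCompact_isOpen_nhds_conj_mem_imp_commute (galAdicCompletionMap (L := L) (IsCMField.complexConj L) hw) (placeForm H w.1)
      hσσ hσc hσi hJw hJd (φ ε₀) (P := Matrix.GeneralLinearGroup.map ψ P₀) (e := finSumFinEquiv) hau' hu1' hP
  -- transport along `φ⁻¹`
  obtain ⟨κ, hκ⟩ := exists_homeomorph_centralizer_map φ ε₀ (φ ε₀) rfl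
  have hκ₀ : κ ⟨ε₀, Subgroup.mem_centralizer_singleton_iff.2 rfl⟩ = ⟨φ ε₀, Subgroup.mem_centralizer_singleton_iff.2 rfl⟩ := Subtype.ext (hκ _)
  refine ⟨κ ⁻¹' B₁', κ.isCompact_preimage.2 hB₁c', hB₁o'.preimage κ.continuous, ?_, fun Ω hΩ => ?_⟩
  · exact (congrArg (· ∈ B₁') hκ₀).mpr hmem'
  · -- push `Ω` forward, pull `C` back
    have hφc : Continuous fun g : (cmDatum L (N₁ + 1) H).Local v => (((φ g : ↥(unitaryGroupOfForm (galAdicCompletionMap (L := L) (IsCMField.complexConj L) hw) (placeForm H w.1))) : GL (Fin (N₁ + 1)) (w.1.adicCompletion L)) : Matrix (Fin (N₁ + 1)) (Fin (N₁ + 1)) (w.1.adicCompletion L)) :=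
      (Units.continuous_val.comp continuous_subtype_val).comp φ.continuous
    obtain ⟨C', hCc', hC'⟩ := hmain' _ (hΩ.image hφc)
    refine ⟨(φ.symm : ↥(unitaryGroupOfForm (galAdicCompletionMap (L := L) (IsCMField.complexConj L) hw) (placeForm H w.1)) → (cmDatum L (N₁ + 1) H).Local v) '' C', hCc'.image φ.symm.continuous, fun x t ht hxt => ?_⟩
    -- apply the field-level clause to `φ x`, `κ t`
    have hκt : ((κ t : ↥(Subgroup.centralizer ({φ ε₀} : Set ↥(unitaryGroupOfForm (galAdicCompletionMap (L := L) (IsCMField.complexConj L) hw) (placeForm H w.1))))) : ↥(unitaryGroupOfForm (galAdicCompletionMap (L := L) (IsCMField.complexConj L) hw) (placeForm H w.1))) = φ (t : (cmDatum L (N₁ + 1) H).Local v) := hκ t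
    have h2 : φ (x * (t : (cmDatum L (N₁ + 1) H).Local v)) = φ x * φ (t : (cmDatum L (N₁ + 1) H).Local v) := map_mul φ _ _
    have h1 : φ (x * (t : (cmDatum L (N₁ + 1) H).Local v) * x⁻¹) = φ (x * (t : (cmDatum L (N₁ + 1) H).Local v)) * φ x⁻¹ := map_mul φ _ _
    have h3 : φ x⁻¹ = (φ x)⁻¹ := map_inv φ _
    have hconj : (φ x) * ((κ t : ↥(Subgroup.centralizer ({φ ε₀} : Set ↥(unitaryGroupOfForm (galAdicCompletionMap (L := L) (IsCMField.complexConj L) hw) (placeForm H w.1))))) : ↥(unitaryGroupOfForm (galAdicCompletionMap (L := L) (IsCMField.complexConj L) hw) (placeForm H w.1))) * (φ x)⁻¹ = φ (x * (t : (cmDatum L (N₁ + 1) H).Local v) * x⁻¹) := by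
      rw [h1, h2, h3, hκt]
    have hmemΩ : ((((φ x) * ((κ t : ↥(Subgroup.centralizer ({φ ε₀} : Set ↥(unitaryGroupOfForm (galAdicCompletionMap (L := L) (IsCMField.complexConj L) hw) (placeForm H w.1))))) : ↥(unitaryGroupOfForm (galAdicCompletionMap (L := L) (IsCMField.complexConj L) hw) (placeForm H w.1))) * (φ x)⁻¹ : ↥(unitaryGroupOfForm (galAdicCompletionMap (L := L) (IsCMField.complexConj L) hw) (placeForm H w.1))) :
        GL (Fin (N₁ + 1)) (w.1.adicCompletion L)) : Matrix (Fin (N₁ + 1)) (Fin (N₁ + 1)) (w.1.adicCompletion L)) ∈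
        (fun g : (cmDatum L (N₁ + 1) H).Local v => (((φ g : ↥(unitaryGroupOfForm (galAdicCompletionMap (L := L) (IsCMField.complexConj L) hw) (placeForm H w.1))) : GL (Fin (N₁ + 1)) (w.1.adicCompletion L)) : Matrix (Fin (N₁ + 1)) (Fin (N₁ + 1)) (w.1.adicCompletion L))) '' Ω :=
      ⟨x * (t : (cmDatum L (N₁ + 1) H).Local v) * x⁻¹, hxt, by rw [hconj]⟩
    obtain ⟨c', hc'C, hcomm⟩ := hC' (φ x) (κ t) ht hmemΩ
    -- `c'⁻¹ φ x ∈ Z(φ ε₀)` hence `φ⁻¹(c'⁻¹ φ x) ∈ Z(ε₀)`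
    have hz : (c'⁻¹ * φ x : ↥(unitaryGroupOfForm (galAdicCompletionMap (L := L) (IsCMField.complexConj L) hw) (placeForm H w.1))) * φ ε₀ = φ ε₀ * (c'⁻¹ * φ x) := Subtype.ext (Units.ext hcomm.eq)
    have hzmem : (c'⁻¹ * φ x : ↥(unitaryGroupOfForm (galAdicCompletionMap (L := L) (IsCMField.complexConj L) hw) (placeForm H w.1))) ∈ Subgroup.centralizer ({φ ε₀} : Set ↥(unitaryGroupOfForm (galAdicCompletionMap (L := L) (IsCMField.complexConj L) hw) (placeForm H w.1))) := Subgroup.mem_centralizer_singleton_iff.2 hz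
    have hcoe : ((κ.symm ⟨c'⁻¹ * φ x, hzmem⟩).1 : (cmDatum L (N₁ + 1) H).Local v) = φ.symm (c'⁻¹ * φ x) := by
      have h := hκ (κ.symm ⟨c'⁻¹ * φ x, hzmem⟩)
      rw [κ.apply_symm_apply] at h
      -- `h : c'⁻¹ * φ x = φ ↑(κ.symm _)`
      have h' := congrArg φ.symm h
      rw [φ.symm_apply_apply] at h'
      exact h'.symm
    have hz' : (φ.symm (c'⁻¹ * φ x) : (cmDatum L (N₁ + 1) H).Local v) ∈ Subgroup.centralizer ({ε₀} : Set ((cmDatum L (N₁ + 1) H).Local v)) := by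
      rw [← hcoe]
      exact (κ.symm ⟨c'⁻¹ * φ x, hzmem⟩).2
    have hfin : (φ.symm c' : (cmDatum L (N₁ + 1) H).Local v) * φ.symm (c'⁻¹ * φ x) = x := by
      have h4 : φ.symm (c' * (c'⁻¹ * φ x)) = φ.symm c' * φ.symm (c'⁻¹ * φ x) := map_mul φ.symm _ _
      have h5 : c' * (c'⁻¹ * φ x) = φ x := mul_inv_cancel_left c' (φ x)
      have h6 : φ.symm (φ x) = x := φ.symm_apply_apply x
      exact h4.symm.trans ((congrArg φ.symm h5).trans h6)
    exact Set.mem_mul.2 ⟨φ.symm c', ⟨c', hc'C, rfl⟩, φ.symm (c'⁻¹ * φ x), hz', hfin⟩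

end CompactModCentralizer

end Literature.NumberTheory.Rogawski1990
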